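import Summits.PneNP.PneNP.Theorems.SoloBlindStreamingSimulation
import HarnessLib

/-!
# The sandwich `MCSP[s] ∉ P ⟹ StreamingLowerBound s ⟹ PneNP`

Upper calibration of the McKay–Murray–Williams streaming hypothesis of corridor B.  THEOREM C
(`SoloBlindTimeConstructible`) proved, for every time-constructible `s`,
`StreamingLowerBound s → P ≠ NP` with
`StreamingLowerBound s := ∀ c, MCSP[s] ∉ USTREAM (s(log N)^c + c) (s(log N)^c + c)`;
`SoloBlindStreamingSimulation` proved `USTREAM S T ⊆ P` for polynomially bounded `S, T`.  Here:

* `pow_log_bound`: for `s n ≤ 2^(a n + a)` the streaming bounds `s (log N)^c + c` are bounded by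
  `N^k + k`, `k = 2^{ac} + 2ac + c`;
* `streamingLowerBound_of_MCSPSize_not_mem_P`: for such `s`, `MCSP[s] ∉ P → StreamingLowerBound s`;
* `MCSPSize_mem_NP_of_codeFP`: `MCSP[s] ∈ NP` whenever `s` is computed on codes (the Karp
  reduction `w ↦ ⟨w, s (log |w|)⟩` to `MCSP ∈ NP`), hence `pneNP_of_MCSPSize_not_mem_P`:
  `MCSP[s] ∉ P → PneNP` directly;
* `streamingLowerBound_sandwich`: for time-constructible `s ≤ 2^{a n + a}`,
  `(MCSP[s] ∉ P → StreamingLowerBound s) ∧ (StreamingLowerBound s → PneNP)`.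

So the one open input of corridor B sits between two plain statements about polynomial time,
`MCSP[s] ∉ P ⟹ StreamingLowerBound s ⟹ SAT ∉ P`: it follows from the standard belief that
`MCSP[s] ∉ P` (Kabanets–Cai 2000: `MCSP ∈ P` would break pseudorandom function generators and
give `BPP`-factoring-type consequences), and the magnification theorem says that the apparently
much weaker streaming form — `MCSP[s]` has no uniform one-pass algorithm with `poly(s(log N))`
memory and update time — already suffices for `P ≠ NP`.  Closing the sandwich from below
(`StreamingLowerBound s → MCSP[s] ∉ P`) is not claimed: a polynomial-time algorithm for `MCSP[s]`
need not be a small-memory one-pass algorithm.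

References: D. M. McKay, C. D. Murray, R. R. Williams, *Weak lower bounds on resource-bounded
compression imply strong separations of complexity classes*, STOC 2019, Thm. 1.3; V. Kabanets,
J.-Y. Cai, *Circuit minimization problem*, STOC 2000, §2–3 (`MCSP ∈ NP`; consequences of
`MCSP ∈ P`).
-/

namespace Summit.PneNP.PneNP.Theorems.SoloBlind

open Computability Polynomial
open Literature.Computability.Complexity
open Literature.Computability.Complexity.CodeFP (natE unE bitE pairE strE pairE_apply)
open Literature.Computability.MetaComplexity
open Literature.Computability.MetaComplexity.McKayMurrayWilliams2019

/-- The exponent bookkeeping: for `s n ≤ 2^(a n + a)` the streaming bounds `s (log N)^c + c` are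
polynomially bounded in `N`. [folklore] -/
theorem pow_log_bound {s : ℕ → ℕ} {a : ℕ} (hs : ∀ n, s n ≤ 2 ^ (a * n + a)) (c N : ℕ) :
    s (Nat.log 2 N) ^ c + c ≤
      N ^ (2 ^ (a * c) + 2 * (a * c) + c) + (2 ^ (a * c) + 2 * (a * c) + c) := by
  set k := 2 ^ (a * c) + 2 * (a * c) + c with hk
  have hk0 : 0 < 2 ^ (a * c) := Nat.two_pow_pos _
  have h1 : s (Nat.log 2 N) ^ c ≤ 2 ^ (a * c) * (2 ^ Nat.log 2 N) ^ (a * c) :=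
    calc s (Nat.log 2 N) ^ c ≤ (2 ^ (a * Nat.log 2 N + a)) ^ c := Nat.pow_le_pow_left (hs _) c
      _ = 2 ^ (a * c) * (2 ^ Nat.log 2 N) ^ (a * c) := by
          rw [← pow_mul, ← pow_mul, ← pow_add,
            show (a * Nat.log 2 N + a) * c = a * c + Nat.log 2 N * (a * c) by ring]
  rcases Nat.lt_or_ge N 2 with hN | hN
  · have hlog : Nat.log 2 N = 0 := Nat.log_eq_zero_iff.2 (Or.inl hN)
    rw [hlog, pow_zero, one_pow, mul_one] at h1
    have : 2 ^ (a * c) + c ≤ N ^ k + k := le_add_left (by omega)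
    rw [hlog]; omega
  · have h2 : (2 ^ Nat.log 2 N) ^ (a * c) ≤ N ^ (a * c) :=
      Nat.pow_le_pow_left (Nat.pow_log_le_self 2 (by omega)) _
    have h4 : 2 ^ (a * c) ≤ N ^ (a * c) := Nat.pow_le_pow_left hN _
    have h5 : N ^ (a * c) * N ^ (a * c) ≤ N ^ k := by
      rw [← pow_add]; exact Nat.pow_le_pow_right (by omega) (by omega)
    calc s (Nat.log 2 N) ^ c + c ≤ 2 ^ (a * c) * (2 ^ Nat.log 2 N) ^ (a * c) + c :=
          Nat.add_le_add_right h1 c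
      _ ≤ N ^ (a * c) * N ^ (a * c) + c := by gcongr
      _ ≤ N ^ k + k := Nat.add_le_add h5 (by omega)

/-- **Upper calibration.** For `s n ≤ 2^(a n + a)` (in particular every `s n ≤ 2^n`),
`MCSP[s] ∉ P → StreamingLowerBound s`: a uniform streaming algorithm with `s (log N)^c + c` space
and update time would put `MCSP[s]` in `P`. [cite: McKayMurrayWilliams2019, Thm. 1.3 (context)] -/
theorem streamingLowerBound_of_MCSPSize_not_mem_P {s : ℕ → ℕ} {a : ℕ}
    (hs : ∀ n, s n ≤ 2 ^ (a * n + a)) (h : MCSPSize s ∉ Classes.P) :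
    StreamingLowerBound s := fun c hmem =>
  h (USTREAM_subset_P (k := 2 ^ (a * c) + 2 * (a * c) + c) (pow_log_bound hs c)
    (pow_log_bound hs c) hmem)

/-- **`MCSP[s] ∈ NP` for size bounds computed on codes**: `w ↦ ⟨w, s (log |w|)⟩` is a Karp
reduction to `MCSP ∈ NP`. [cite: KabanetsCai2000, §2 (MCSP ∈ NP)] -/
theorem MCSPSize_mem_NP_of_codeFP {s : ℕ → ℕ} (hsC : CodeFP unE natE s) :
    MCSPSize s ∈ Nondeterministic.NP := by
  obtain ⟨r, hrFP, hr⟩ : CodeFP strE (pairE strE natE) (fun w => (w, s (Nat.log 2 w.length))) :=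
    ((CodeFP.id strE).pair (hsC.comp (CStream.cf_log.comp CodeFP.strNatLength))).congr
      fun _ => rfl
  have hpre : MCSPSize s = r ⁻¹' MCSP := by
    ext w
    change w ∈ MCSPSize s ↔ r w ∈ MCSP
    rw [show r w = boolPair w (encodeNat (s (Nat.log 2 w.length))) from hr w]
    constructor
    · rintro ⟨n, f, rfl, hf⟩
      rw [boolPair_truthTable_mem_MCSP_iff, length_truthTable, Nat.log_pow one_lt_two]
      exact hf
    · rintro ⟨m, g, t, hw, hg⟩
      have h1 : (w, encodeNat (s (Nat.log 2 w.length))) = (truthTable g, encodeNat t) :=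
        boolPair_injective hw
      obtain ⟨rfl, h2⟩ := Prod.mk.inj h1
      have ht := congrArg decodeNat h2
      rw [decode_encodeNat, decode_encodeNat, length_truthTable, Nat.log_pow one_lt_two] at ht
      exact ⟨m, g, rfl, ht ▸ hg⟩
  rw [hpre]
  exact preimage_mem_NP MCSP_mem_NP_holds hrFP

/-- **`MCSP[s] ∉ P → P ≠ NP`** for size bounds computed on codes. [cite: KabanetsCai2000, §2] -/
theorem pneNP_of_MCSPSize_not_mem_P {s : ℕ → ℕ} (hsC : CodeFP unE natE s)
    (h : MCSPSize s ∉ Classes.P) : PneNP :=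
  pneNP_iff_P_ne_NP.2 fun hPNP => h (by rw [hPNP]; exact MCSPSize_mem_NP_of_codeFP hsC)

/-- **The sandwich around the McKay–Murray–Williams hypothesis.** For time-constructible
`s ≤ 2^{a n + a}`: `MCSP[s] ∉ P ⟹ StreamingLowerBound s ⟹ PneNP` — the upper implication is the
simulation of this file, the lower one is THEOREM C (`pneNP_of_streamingLowerBound_tc`).
[cite: McKayMurrayWilliams2019, Thm. 1.3] -/
theorem streamingLowerBound_sandwich {s : ℕ → ℕ} (hsT : IsTimeConstructible s) {a : ℕ}
    (hs : ∀ n, s n ≤ 2 ^ (a * n + a)) :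
    (MCSPSize s ∉ Classes.P → StreamingLowerBound s) ∧ (StreamingLowerBound s → PneNP) :=
  ⟨streamingLowerBound_of_MCSPSize_not_mem_P hs, pneNP_of_streamingLowerBound_tc hsT⟩

end Summit.PneNP.PneNP.Theorems.SoloBlind
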